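import Summits.Ventures.QEC.Thresholds.PlanarLossThresholdHalf
import Summits.Ventures.QEC.Thresholds.PlanarSurfaceCodeSAWThresholds
import Summits.Ventures.QEC.Thresholds.LossErrorThresholdConverses
import Literature.InformationTheory.QuantumCodes.PlanarCodeLossErrorPhaseBoundary
import Literature.InformationTheory.QuantumCodes.CSSMixedChannelFamilies
import Literature.InformationTheory.QuantumCodes.CSSEquivalenceMixedNoise
import HarnessLib

/-!
# The loss–error phase boundary of the PLANAR surface code (census `HGP(H, Hᵀ)`, `k = 1`)

Venture QEC, `Summits/Ventures/QEC/Thresholds/` (LADDER-QEC rung Q5; qec-type-03 gen 6, PARTITION item 145 «03.PLANARPHASE»).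
The planar companion of `ToricCodeLossErrorPhaseBoundary.lean`: the `k`-th planar surface code `planarHGPCode k` under heralded
LOSSES (rate `y`, known locations) AND independent Pauli errors of the sector (rate `p`), decoded by any family `D` of
minimum-weight-outside-the-losses decoders (Stace–Barrett–Doherty 2009 "by extension planar codes"; Stace–Barrett 2010),
`p_c(y) := accuracyThreshold (k ↦ p ↦ Prob[failure])`.

The Literature side (`PlanarCodeLossErrorRuns/Skeletons/SkeletonSum/PhaseBoundary.lean`) proves the Peierls argument on the
degraded lattice along rough-to-rough crossing paths GRANTED the odd-crossing property of the non-trivial logicals; this file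
discharges that property from `k = 1` (type-09's `planar_bottomCrossing_eq_one`, from `planar_logical_add_string_mem`) and
assembles the certified phase diagram:

| loss rate | certified statement | source |
|---|---|---|
| `0 ≤ y < 1/2` | `0 < p_c(y)` (Peierls on the degraded lattice; BK + Kesten), both sectors | this file |
| `0 ≤ y < 1/2` | `p_c(y) ≤ (1 - 2y)/(4(1 - y))` for EVERY decoder (no-cloning ceiling curve) | `planar_mixed_accuracyThreshold_le` (lit-2) |
| `1/2 ≤ y ≤ 1` | `p_c(y) = 0` for EVERY decoder | this file (from `planar_loss_tendsto_one`, type-03 g5) |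
| `p = 0` axis | loss threshold `= 1/2` exactly | `planar_erasure_accuracyThreshold_eq_half` (type-03 g5) |

★ `planar_mixed_accuracyThreshold_pos_iff : 0 < p_c(y) ↔ y < 1/2` (`0 ≤ y ≤ 1`), so the loss rates at which the planar code
keeps a positive error threshold are EXACTLY `[0, 1/2)` (`planar_lossError_correctableLossRates_eq`, both sectors). HONEST
FRAMING: the numerical position of the boundary curve inside the strip `0 < p_c(y) ≤ (1-2y)/(4(1-y))` (Stace–Barrett 2010's
numerics) is not claimed; `p₀(y)` is Kesten's non-explicit decay rate fed through an explicit Peierls constant.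
UNCONDITIONAL, 0 named facts.

## References

* [StaceBarrettDoherty2009] T. M. Stace, S. D. Barrett, A. C. Doherty, *Thresholds for topological codes in the presence of
  loss*, PRL 102 (2009) 200501, p. 1 (abstract), p. 2–3 and Fig. 2.
* [StaceBarrett2010] T. M. Stace, S. D. Barrett, *Error correction and degeneracy in surface codes suffering loss*, PRA 81
  (2010) 022317, arXiv:0912.1159 (planar code with loss and errors, numerics).
* [KestenCMP1980] H. Kesten, Comm. Math. Phys. 74 (1980) 41–59, Thm. 1, Thm. 2 (1.7).
* [DumerKovalevPryadko2015] I. Dumer, A. A. Kovalev, L. P. Pryadko, PRL 115 (2015) 050502, Thm. 2 (the decoder class).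
* [TillichZemor2014] J.-P. Tillich, G. Zémor, IEEE Trans. IT 60 (2014) 1193, §3 and Thm 7 (the planar code, k = 1).
-/

noncomputable section

namespace Summit.Ventures.QEC.Thresholds

open Filter Topology Matrix
open Literature.InformationTheory.QuantumCodes
open Literature.InformationTheory.QuantumCodes.PlanarCode

/-! ### `k = 1`: the odd-crossing property of the non-trivial logicals -/

/-- **The odd-crossing property of the planar code** (the hypothesis `hk1` of the Literature files, discharged): every cycle
of the sector outside the stabilizer crosses the bottom rough boundary an odd number of times (one logical qubit).
[cite: TillichZemor2014, §3 and Thm 7 (k = 1)] -/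
theorem planar_oddCrossing (k : ℕ) :
    ∀ x : PlanarQubit k → ZMod 2, planarHX k *ᵥ x = 0 → x ∉ planarSZ k → ∑ b : Fin (k + 2), x (Sum.inl (0, b)) = 1 :=
  fun _ hx hxS => planar_bottomCrossing_eq_one k hx hxS

/-! ### Census form of the family -/

/-- The census `Z`-sector loss–error failure family of the planar codes (checks `(planarHGPCode k).HX`, trivial errors
`rowSpZ`) IS the Literature family on `planarHX k`, `planarSZ k` (definitional).
[cite: TillichZemor2014, §3 (the planar code as HGP(H, Hᵀ))] -/
theorem planar_zMixedFamily_eq (D : (k : ℕ) → ErasureDecoder (PlanarQubit k) (PlanarCheck k → ZMod 2)) (y : ℝ) :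
    (fun k p => mixedFailureProb (planarHGPCode k).HX ((planarHGPCode k).rowSpZ : Set (PlanarQubit k → ZMod 2)) (D k) y p) =
      fun k p => mixedFailureProb (planarHX k) (planarSZ k : Set (PlanarQubit k → ZMod 2)) (D k) y p := rfl

/-! ### Below the percolation point: a positive error threshold, uniformly over decoders -/

/-- **Uniform exponential decay below a positive error rate**: for every loss rate `0 ≤ y < 1/2` ONE error rate `p₀(y) > 0`
works for all minimum-weight-outside-the-losses decoder families of the planar codes at once: for `0 ≤ p ≤ p₀(y)` the failure
probability decays exponentially in `k`. [cite: StaceBarrettDoherty2009, p. 3 and Fig. 2] [cite: KestenCMP1980, Thm. 2 (1.7)] -/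
theorem planar_mixedFamily_decaysExponentially {y : ℝ} (hy0 : 0 ≤ y) (hy : y < 1 / 2) :
    ∃ p₀ : ℝ, 0 < p₀ ∧ ∀ (D : (k : ℕ) → ErasureDecoder (PlanarQubit k) (PlanarCheck k → ZMod 2)),
      (∀ k, (D k).IsMinWeightOutside (planarHX k)) →
        ∀ p : ℝ, 0 ≤ p → p ≤ p₀ → DecaysExponentially (fun k p =>
          mixedFailureProb (planarHGPCode k).HX ((planarHGPCode k).rowSpZ : Set (PlanarQubit k → ZMod 2)) (D k) y p) p :=
  planar_mixedFamily_decaysExponentially_of_oddCrossing planar_oddCrossing hy0 hy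

/-- **Positive error threshold below the percolation point**: for `0 ≤ y < 1/2` and every family of
minimum-weight-outside-the-losses decoders of the planar codes, `0 < p_c(y)`.
[cite: StaceBarrettDoherty2009, p. 3 and Fig. 2] [cite: KestenCMP1980, Thm. 2 (1.7)] -/
theorem planar_mixed_accuracyThreshold_pos (D : (k : ℕ) → ErasureDecoder (PlanarQubit k) (PlanarCheck k → ZMod 2))
    (hD : ∀ k, (D k).IsMinWeightOutside (planarHX k)) {y : ℝ} (hy0 : 0 ≤ y) (hy : y < 1 / 2) :
    0 < accuracyThreshold (fun k p =>
      mixedFailureProb (planarHGPCode k).HX ((planarHGPCode k).rowSpZ : Set (PlanarQubit k → ZMod 2)) (D k) y p) := by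
  obtain ⟨p₀, hp₀, h⟩ := planar_mixedFamily_decaysExponentially hy0 hy
  have hlb : IsThresholdLowerBound (fun k p =>
      mixedFailureProb (planarHGPCode k).HX ((planarHGPCode k).rowSpZ : Set (PlanarQubit k → ZMod 2)) (D k) y p)
      (min p₀ 1) :=
    fun p hp0 hp => (h D hD p hp0 ((le_of_lt hp).trans (min_le_left _ _))).belowThreshold
  exact lt_of_lt_of_le (lt_min hp₀ one_pos) (le_accuracyThreshold hlb (min_le_right _ _))

/-- **Uniform lower bound** (census reading): for `0 ≤ y < 1/2` one `p₀(y) > 0` satisfies `p₀(y) ≤ p_c(y)` for every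
minimum-weight-outside-the-losses decoder family, with exponential decay for `p ≤ p₀(y)`.
[cite: StaceBarrettDoherty2009, p. 3 and Fig. 2] [cite: KestenCMP1980, Thm. 2 (1.7)] -/
theorem planar_lossError_uniform_lowerBound {y : ℝ} (hy0 : 0 ≤ y) (hy : y < 1 / 2) :
    ∃ p₀ : ℝ, 0 < p₀ ∧ ∀ (D : (k : ℕ) → ErasureDecoder (PlanarQubit k) (PlanarCheck k → ZMod 2)),
      (∀ k, (D k).IsMinWeightOutside (planarHX k)) →
        p₀ ≤ accuracyThreshold (fun k p =>
          mixedFailureProb (planarHGPCode k).HX ((planarHGPCode k).rowSpZ : Set (PlanarQubit k → ZMod 2)) (D k) y p) ∧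
        ∀ p : ℝ, 0 ≤ p → p ≤ p₀ → DecaysExponentially (fun k p =>
          mixedFailureProb (planarHGPCode k).HX ((planarHGPCode k).rowSpZ : Set (PlanarQubit k → ZMod 2)) (D k) y p) p := by
  obtain ⟨p₀, hp₀, h⟩ := planar_mixedFamily_decaysExponentially hy0 hy
  refine ⟨min p₀ 1, lt_min hp₀ one_pos, fun D hD => ⟨?_, fun p hp0 hp => h D hD p hp0 (hp.trans (min_le_left _ _))⟩⟩
  refine le_accuracyThreshold (fun p hp0 hp => ?_) (min_le_right _ _)
  exact (h D hD p hp0 ((le_of_lt hp).trans (min_le_left _ _))).belowThreshold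

/-! ### From the percolation point on: no error rate is tolerable, for ANY erasure-aware decoder -/

/-- **Beyond loss rate `1/2` the planar code tolerates no error rate**: for `1/2 ≤ y ≤ 1` and EVERY family of erasure-aware
decoders, `p_c(y) = 0` (a positive flip rate `q` on the non-lost qubits degrades to the loss rate `y + 2q(1-y) > 1/2`,
where `planar_loss_tendsto_one` applies). [cite: StaceBarrettDoherty2009, p. 2–3 and Fig. 2 (no threshold beyond p_loss = 0.5)] -/
theorem planar_mixed_accuracyThreshold_eq_zero (D : (k : ℕ) → ErasureDecoder (PlanarQubit k) (PlanarCheck k → ZMod 2))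
    {y : ℝ} (hy : 1 / 2 ≤ y) (hy1 : y ≤ 1) :
    accuracyThreshold (fun k p =>
      mixedFailureProb (planarHGPCode k).HX ((planarHGPCode k).rowSpZ : Set (PlanarQubit k → ZMod 2)) (D k) y p) = 0 := by
  set P : ℕ → ℝ → ℝ := fun k p =>
    mixedFailureProb (planarHGPCode k).HX ((planarHGPCode k).rowSpZ : Set (PlanarQubit k → ZMod 2)) (D k) y p with hP
  refine le_antisymm ?_ (accuracyThreshold_nonneg _)
  by_contra hpos
  push Not at hpos
  set a := accuracyThreshold P with ha
  -- a flip rate `0 < q < a`, `q ≤ 1/2`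
  set q : ℝ := min (a / 2) (1 / 2) with hq
  have hq0 : 0 < q := lt_min (by linarith) (by norm_num)
  have hqa : q < a := lt_of_le_of_lt (min_le_left _ _) (by linarith)
  have hq2 : q ≤ 1 / 2 := min_le_right _ _
  have hbelow : BelowThreshold P q := belowThreshold_of_lt_accuracyThreshold hq0.le hqa
  -- the total loss rate `y' = y + 2q(1-y)` is supercritical (or `y = 1`)
  set y' : ℝ := y + (1 - y) * (2 * q) with hy'
  have hy'gt : 1 / 2 < y' := by
    rcases eq_or_lt_of_le hy1 with h1 | h1
    · rw [hy', h1]; norm_num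
    · have : 0 < (1 - y) * (2 * q) := mul_pos (by linarith) (by linarith)
      linarith
  have hy'le : y' ≤ 1 := by
    have : (1 - y) * (2 * q) ≤ (1 - y) * 1 := mul_le_mul_of_nonneg_left (by linarith) (by linarith)
    linarith
  have hone := planar_loss_tendsto_one hy'gt hy'le
  have hle : ∀ k : ℕ, (1 / 2 : ℝ) * planarErasureFamily k y' ≤ P k q := by
    intro k
    have h := uncorrectableProb_le_two_mul_mixedFailureProb (planarHX k) (planarSZ k) (D k) (y := y) (p := q)
      (by linarith) hy1 hq0.le hq2
    change planarErasureFamily k y' ≤ 2 * P k q at h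
    linarith
  have hlim : (1 / 2 : ℝ) * 1 ≤ 0 := le_of_tendsto_of_tendsto' (hone.const_mul (1 / 2)) hbelow hle
  linarith

/-! ### ★ The phase boundary -/

/-- ★ **THE LOSS–ERROR PHASE BOUNDARY OF THE PLANAR SURFACE CODE**: for a loss rate `0 ≤ y ≤ 1` and any family of
minimum-weight-outside-the-losses decoders, the planar surface codes have a POSITIVE error accuracy threshold at loss rate `y`
if and only if `y < 1/2` — the bond-percolation threshold of the square lattice (Kesten).
[cite: StaceBarrettDoherty2009, p. 1 (abstract) and Fig. 2] [cite: StaceBarrett2010, abstract] [cite: KestenCMP1980, Thm. 1] -/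
theorem planar_mixed_accuracyThreshold_pos_iff (D : (k : ℕ) → ErasureDecoder (PlanarQubit k) (PlanarCheck k → ZMod 2))
    (hD : ∀ k, (D k).IsMinWeightOutside (planarHX k)) {y : ℝ} (hy0 : 0 ≤ y) (hy1 : y ≤ 1) :
    0 < accuracyThreshold (fun k p =>
      mixedFailureProb (planarHGPCode k).HX ((planarHGPCode k).rowSpZ : Set (PlanarQubit k → ZMod 2)) (D k) y p) ↔
      y < 1 / 2 := by
  constructor
  · intro h
    by_contra hge
    push Not at hge
    have := planar_mixed_accuracyThreshold_eq_zero D hge hy1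
    linarith
  · exact planar_mixed_accuracyThreshold_pos D hD hy0

/-- ★ **The certified loss–error phase diagram of the planar surface code** (all decoder families of the
minimum-weight-outside-the-losses class): below the percolation point the error threshold is POSITIVE and at most the
no-cloning ceiling `(1 - 2y)/(4(1 - y))`; from the percolation point on it VANISHES.
[cite: StaceBarrettDoherty2009, p. 2–3 and Fig. 2] [cite: KestenCMP1980, Thm. 1] -/
theorem planar_lossError_phaseDiagram (D : (k : ℕ) → ErasureDecoder (PlanarQubit k) (PlanarCheck k → ZMod 2))
    (hD : ∀ k, (D k).IsMinWeightOutside (planarHX k)) {y : ℝ} (hy0 : 0 ≤ y) (hy1 : y ≤ 1) :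
    (y < 1 / 2 →
        0 < accuracyThreshold (fun k p =>
          mixedFailureProb (planarHGPCode k).HX ((planarHGPCode k).rowSpZ : Set (PlanarQubit k → ZMod 2)) (D k) y p) ∧
        accuracyThreshold (fun k p =>
          mixedFailureProb (planarHGPCode k).HX ((planarHGPCode k).rowSpZ : Set (PlanarQubit k → ZMod 2)) (D k) y p) ≤
          (1 - 2 * y) / (4 * (1 - y))) ∧
      (1 / 2 ≤ y →
        accuracyThreshold (fun k p =>
          mixedFailureProb (planarHGPCode k).HX ((planarHGPCode k).rowSpZ : Set (PlanarQubit k → ZMod 2)) (D k) y p) = 0) :=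
  ⟨fun hy => ⟨planar_mixed_accuracyThreshold_pos D hD hy0 hy, planar_mixed_accuracyThreshold_le D hy0 hy⟩,
    fun hy => planar_mixed_accuracyThreshold_eq_zero D hy hy1⟩

/-- ★ **The loss rates with a positive error threshold are EXACTLY `[0, 1/2)`**: for every family of
minimum-weight-outside-the-losses decoders of the planar codes, `{y ∈ [0,1] | 0 < p_c(y)} = [0, 1/2)`.
[cite: StaceBarrettDoherty2009, p. 1 (abstract: the maximum tolerable loss rate is 50%) and Fig. 2] [cite: KestenCMP1980, Thm. 1] -/
theorem planar_lossError_correctableLossRates_eq (D : (k : ℕ) → ErasureDecoder (PlanarQubit k) (PlanarCheck k → ZMod 2))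
    (hD : ∀ k, (D k).IsMinWeightOutside (planarHX k)) :
    {y : ℝ | 0 ≤ y ∧ y ≤ 1 ∧ 0 < accuracyThreshold (fun k p =>
        mixedFailureProb (planarHGPCode k).HX ((planarHGPCode k).rowSpZ : Set (PlanarQubit k → ZMod 2)) (D k) y p)} =
      Set.Ico 0 (1 / 2) := by
  ext y
  simp only [Set.mem_setOf_eq, Set.mem_Ico]
  constructor
  · rintro ⟨hy0, hy1, hpos⟩
    exact ⟨hy0, (planar_mixed_accuracyThreshold_pos_iff D hD hy0 hy1).1 hpos⟩
  · rintro ⟨hy0, hy⟩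
    exact ⟨hy0, by linarith, planar_mixed_accuracyThreshold_pos D hD hy0 hy⟩

/-! ### The second sector (checks `H_Z`, smooth-to-smooth logicals) by the coordinate-swap self-duality -/

/-- **The `X`-sector loss–error family IS a `Z`-sector family** of the conjugate decoders (the `X ↔ Z` exchanged planar code
is the planar code re-indexed, `planarHGPCode_swap_eq_reindex`; transport of `mixedFailureProb`).
[cite: TillichZemor2014, §3 (HGP(H, Hᵀ) and its transpose symmetry)] [cite: StaceBarrettDoherty2009, p. 2] -/
theorem planar_xMixedFamily_eq (DX : (k : ℕ) → ErasureDecoder (PlanarQubit k) (PlanarZCheck k → ZMod 2)) (y : ℝ) :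
    (fun k p => mixedFailureProb (planarHGPCode k).HZ ((planarHGPCode k).rowSpX : Set (PlanarQubit k → ZMod 2)) (DX k) y p) =
      fun k p => mixedFailureProb (planarHGPCode k).HX ((planarHGPCode k).rowSpZ : Set (PlanarQubit k → ZMod 2))
        (CSSCode.reindexErasureDecoder (Equiv.prodComm (Fin (k + 2)) (Fin (k + 1))).symm.symm
          (Equiv.sumCongr (Equiv.prodComm (Fin (k + 2)) (Fin (k + 2)))
            (Equiv.prodComm (Fin (k + 1)) (Fin (k + 1)))).symm.symm (DX k)) y p := by
  funext k p
  have h : mixedFailureProb (planarHGPCode k).HZ ((planarHGPCode k).rowSpX : Set (PlanarQubit k → ZMod 2)) (DX k) y p =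
      mixedFailureProb (planarHGPCode k).swap.HX ((planarHGPCode k).swap.rowSpZ : Set (PlanarQubit k → ZMod 2)) (DX k) y p :=
    rfl
  rw [h, planarHGPCode_swap_eq_reindex k, CSSCode.mixedFailureProb_reindex_symm]

/-- The conjugate decoders of minimum-weight-outside-the-losses `X`-decoders are minimum-weight-outside-the-losses
`Z`-decoders. [cite: DumerKovalevPryadko2015, Thm 2 (the decoder class)] -/
theorem planar_xPullback_isMinWeightOutside (DX : (k : ℕ) → ErasureDecoder (PlanarQubit k) (PlanarZCheck k → ZMod 2))
    (hDX : ∀ k, (DX k).IsMinWeightOutside (planarHGPCode k).HZ) (k : ℕ) :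
    (CSSCode.reindexErasureDecoder (Equiv.prodComm (Fin (k + 2)) (Fin (k + 1))).symm.symm
      (Equiv.sumCongr (Equiv.prodComm (Fin (k + 2)) (Fin (k + 2)))
        (Equiv.prodComm (Fin (k + 1)) (Fin (k + 1)))).symm.symm (DX k)).IsMinWeightOutside (planarHX k) :=
  CSSCode.isMinWeightOutside_reindexErasureDecoder_symm (planarHGPCode k)
    (Equiv.prodComm (Fin (k + 2)) (Fin (k + 1))).symm (Equiv.prodComm (Fin (k + 1)) (Fin (k + 2))).symm
    (Equiv.sumCongr (Equiv.prodComm (Fin (k + 2)) (Fin (k + 2))) (Equiv.prodComm (Fin (k + 1)) (Fin (k + 1)))).symm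
    (D' := DX k) (by rw [← planarHGPCode_swap_eq_reindex]; exact hDX k)

/-- ★ **Phase boundary, second sector**: for `0 ≤ y ≤ 1` and every family of minimum-weight-outside-the-losses decoders of
the `H_Z`-detected sector of the planar codes, the error accuracy threshold at loss rate `y` is positive iff `y < 1/2`.
[cite: StaceBarrettDoherty2009, p. 1 (abstract) and Fig. 2] [cite: KestenCMP1980, Thm. 1] -/
theorem planar_x_mixed_accuracyThreshold_pos_iff (DX : (k : ℕ) → ErasureDecoder (PlanarQubit k) (PlanarZCheck k → ZMod 2))
    (hDX : ∀ k, (DX k).IsMinWeightOutside (planarHGPCode k).HZ) {y : ℝ} (hy0 : 0 ≤ y) (hy1 : y ≤ 1) :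
    0 < accuracyThreshold (fun k p =>
      mixedFailureProb (planarHGPCode k).HZ ((planarHGPCode k).rowSpX : Set (PlanarQubit k → ZMod 2)) (DX k) y p) ↔
      y < 1 / 2 := by
  rw [planar_xMixedFamily_eq]
  exact planar_mixed_accuracyThreshold_pos_iff _ (planar_xPullback_isMinWeightOutside DX hDX) hy0 hy1

/-- **Second sector, beyond `1/2`**: `p_c(y) = 0` for `1/2 ≤ y ≤ 1` and EVERY erasure-aware `X`-decoder family.
[cite: StaceBarrettDoherty2009, p. 2–3 and Fig. 2] -/
theorem planar_x_mixed_accuracyThreshold_eq_zero (DX : (k : ℕ) → ErasureDecoder (PlanarQubit k) (PlanarZCheck k → ZMod 2))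
    {y : ℝ} (hy : 1 / 2 ≤ y) (hy1 : y ≤ 1) :
    accuracyThreshold (fun k p =>
      mixedFailureProb (planarHGPCode k).HZ ((planarHGPCode k).rowSpX : Set (PlanarQubit k → ZMod 2)) (DX k) y p) = 0 := by
  rw [planar_xMixedFamily_eq]
  exact planar_mixed_accuracyThreshold_eq_zero _ hy hy1

/-- ★ **Both sectors**: the loss rates at which the planar codes keep a positive error threshold are EXACTLY `[0, 1/2)` in
the `H_X`-detected sector AND in the `H_Z`-detected sector (any minimum-weight-outside-the-losses decoder families `D`, `DX`).
[cite: StaceBarrettDoherty2009, p. 1 (abstract) and Fig. 2] [cite: KestenCMP1980, Thm. 1] -/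
theorem planar_lossError_correctableLossRates_eq_bothSectors
    (D : (k : ℕ) → ErasureDecoder (PlanarQubit k) (PlanarCheck k → ZMod 2))
    (hD : ∀ k, (D k).IsMinWeightOutside (planarHGPCode k).HX)
    (DX : (k : ℕ) → ErasureDecoder (PlanarQubit k) (PlanarZCheck k → ZMod 2))
    (hDX : ∀ k, (DX k).IsMinWeightOutside (planarHGPCode k).HZ) :
    {y : ℝ | 0 ≤ y ∧ y ≤ 1 ∧ 0 < accuracyThreshold (fun k p =>
        mixedFailureProb (planarHGPCode k).HX ((planarHGPCode k).rowSpZ : Set (PlanarQubit k → ZMod 2)) (D k) y p)} =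
      Set.Ico 0 (1 / 2) ∧
    {y : ℝ | 0 ≤ y ∧ y ≤ 1 ∧ 0 < accuracyThreshold (fun k p =>
        mixedFailureProb (planarHGPCode k).HZ ((planarHGPCode k).rowSpX : Set (PlanarQubit k → ZMod 2)) (DX k) y p)} =
      Set.Ico 0 (1 / 2) := by
  refine ⟨planar_lossError_correctableLossRates_eq D hD, ?_⟩
  ext y
  simp only [Set.mem_setOf_eq, Set.mem_Ico]
  constructor
  · rintro ⟨hy0, hy1, hpos⟩
    exact ⟨hy0, (planar_x_mixed_accuracyThreshold_pos_iff DX hDX hy0 hy1).1 hpos⟩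
  · rintro ⟨hy0, hy⟩
    exact ⟨hy0, by linarith, (planar_x_mixed_accuracyThreshold_pos_iff DX hDX hy0 (by linarith)).2 hy⟩

/-! ### Non-vacuity: the canonical decoders, and both sides of the boundary exhibited -/

/-- **Non-vacuity of the decoder class and of BOTH directions of the `↔`**: with the canonical
minimum-weight-outside-the-losses decoders of the planar codes, the error threshold is POSITIVE at loss rate `1/4` and ZERO
at loss rate `1/2`. [cite: DumerKovalevPryadko2015, p. 3 (exhaustive search decoder)] [cite: StaceBarrettDoherty2009, Fig. 2] -/
theorem planar_lossError_nonvacuous :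
    0 < accuracyThreshold (fun k p => mixedFailureProb (planarHGPCode k).HX
        ((planarHGPCode k).rowSpZ : Set (PlanarQubit k → ZMod 2)) (ErasureDecoder.minWeightOutside (planarHX k)) (1 / 4) p) ∧
      accuracyThreshold (fun k p => mixedFailureProb (planarHGPCode k).HX
        ((planarHGPCode k).rowSpZ : Set (PlanarQubit k → ZMod 2)) (ErasureDecoder.minWeightOutside (planarHX k)) (1 / 2) p) =
        0 :=
  ⟨planar_mixed_accuracyThreshold_pos (fun k => ErasureDecoder.minWeightOutside (planarHX k))
      planar_minWeightOutside_isMinWeightOutside (by norm_num) (by norm_num),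
    planar_mixed_accuracyThreshold_eq_zero _ (by norm_num) (by norm_num)⟩

/-- **Non-vacuity, general loss rate**: with the canonical minimum-weight-outside-the-losses decoders the planar codes have
a positive error threshold at every loss rate `0 ≤ y < 1/2`. [cite: DumerKovalevPryadko2015, p. 3 (exhaustive search decoder)] -/
theorem planar_lossError_accuracyThreshold_pos_minWeightOutside {y : ℝ} (hy0 : 0 ≤ y) (hy : y < 1 / 2) :
    0 < accuracyThreshold (fun k p => mixedFailureProb (planarHGPCode k).HX
      ((planarHGPCode k).rowSpZ : Set (PlanarQubit k → ZMod 2)) (ErasureDecoder.minWeightOutside (planarHX k)) y p) :=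
  planar_mixed_accuracyThreshold_pos _ planar_minWeightOutside_isMinWeightOutside hy0 hy

end Summit.Ventures.QEC.Thresholds
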